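import Literature.MathematicalPhysics.QuantumFieldTheory.Balaban1983to89.B9Ineq368PPrime

/-!
# `Balaban1983to89.B9Ineq349Hom` — [Balaban1985BackgroundPropagators] p. 399 (3.49), the kernel bounds of
# `P(U) = I − R(U) = G′Q′*(Q′G′²Q′*)⁻¹Q′G′` ((3.25)) and of its dressings `DP`, `PD*`, `DPD*`, in the block-majorant
# (operator) form of [4] (2.51) WITH EVERY LETTER TYPED BETWEEN ITS OWN TWO CARRIERS: `G′` on the site functions,
# `Q′` from site functions to functions on the coarse lattice, `(Q′G′²Q′*)⁻¹` on the coarse lattice, `Q′*` back,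
# `D = ∇_U` from sites to bonds, `D* = ∇*_U` from bonds to sites — so that the `P`-entry hypotheses of
# `B9Ineq377POneConcrete.thm34_G_entries13_concreteV₃P₁` (typed `HasMajorant`/`HasMajorantHom` composites) are reached
# from Theorem-3.1/3.2-shaped inputs without any one-carrier embedding

statement-level skeleton of published theorems with citation tags; proofs where landed; nothing here is a claim about the Yang–Mills mass gap

DOCFIX (cell `lit-balaban`, seat r06 gen 15, 2026-08-22; p37 `CITELOC-SWEEP-B4B9.md` §2b page-numeral slips, text layer re-read): (3.19) is p. 393 [PDF 5] ((3.20)–(3.25) p. 394) — the locators of (3.19) in this file corrected accordingly (5 place(s)); declarations, statements and proofs byte-identical to the tree copy of record (p312202).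

CITATION HEADER (lean-in-tree rule).  B9 = T. Bałaban, *Propagators for lattice gauge theories in a background field*, Commun. Math. Phys.
**99** (1985) 389–434 [Balaban1985BackgroundPropagators] (held `paper:balaban1985-cmp99-background-propagators`; journal page = PDF page + 388):
(3.49) p. 399 [PDF 11] and the two sentences around it; (3.25) p. 394 [PDF 6] (`R = I − G′Q′*(Q′G′²Q′*)⁻¹Q′G′`); Theorem 3.1 (3.42) p. 397,
Theorem 3.2 (3.48) p. 398 and the scale-transfer remark p. 398 («we may replace the factor (Lʲη)^α by (Lʲη)^β(L^{j′}η)^γ with β + γ = α»);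
(3.19) p. 393 (the averaging operators `Q′_j(U)`, block-local); p. 403 [PDF 15] «the operator P(U′U) satisfies the bounds (3.49)».
[4] = T. Bałaban, *Propagators and renormalization transformations for lattice gauge theories. II*, Commun. Math. Phys. **96** (1984) 223–250
[Balaban1984PropagatorsII]: (2.51)–(2.55) p. 232 («this property is preserved under the composition of operators possessing it»), (2.54) p. 233,
Lemma 2.1 (2.60)–(2.61) p. 234, (2.68) p. 235.  Text re-read this session from the held text layer (`lit read`, PDF pp. 6, 11, 15).
Cell `lit-balaban`, seat r06 (B9 fold owner) gen 12, FILE 12 of the Sect. B programme; rows B9.Eq3.49 × B9.Eq3.25 × B9.Thm3.1 × B9.Thm3.2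
(and the `P`-inputs of rows B9.Eq3.76 / B9.Thm3.4).

THE PRINT (p. 399, verbatim from the text layer, display restored from the render): «These theorems imply all the properties of the operator R,
or DRD\*, we will need in the future. For the operator P = I − R we obtain, using again Lemma 2.1,
[|P(x,x′)|, |(DP)_μ(x,x′)|, |(PD\*)_ν(x,x′)|, |(DPD\*)_{μν}(x,x′)|] ≦ O(1)[1, (Lʲη)⁻¹, (Lʲη)⁻¹, (Lʲη)⁻²](L^{j′}η)^{−d}e^{−(1/2)δ₀d(y,y′)}
for x ∈ Δ(y), y ∈ Λ_j, x′ ∈ Δ(y′), y′ ∈ Λ_{j′}. (3.49)  We have also the corresponding bounds for Hölder norms of the kernel (DPD\*)_{μν}(x,x′).»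

WHY THIS FILE (what was open).  The cell's operator form of (3.49), `B9Ineq368PPrime.ineq349_op` (r06 gen 6), types ALL letters as endomorphisms of
ONE carrier `W` (sites, bonds and coarse points thrown together, one block map).  The concrete Sect. B files type each letter between its own carriers:
`G′(U)` on the real site coordinates `S × ι`, `D = conjHom b (gradLin …)` from `S × ι` to the bond coordinates `(κ × S) × ι`, `D*` back
(`B9Eq376POneLetters`), and `B9Ineq377POneConcrete.thm34_G_entries13_concreteV₃P₁` asks for the (3.49) entries of `P(U)` in exactly that typing:
`hP : P ≺ κ_P e^{−δ_P d}` (sites), `hDP : D ∘ₗ P ≺ κ_P(Lʲη)⁻¹e^{−δ_P d}` (sites → bonds), `hPDs : P ∘ₗ D* ≺ κ_P(Lʲη)⁻¹e^{−δ_P d}` (bonds → sites).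
Since `Q′ : sites → coarse lattice` is a THIRD carrier, the one-carrier device does not apply verbatim; instead of a 3 × 3 block embedding this file
redoes the (short) composition bookkeeping of `B9Ineq368PPrime` §2–§3 with pv21's two-space majorants `B6RandomWalkHom.HasMajorantHom` and its
three-lattice composition `hasMajorantHom_comp` ([4] (2.52) through a middle lattice).

WHAT THIS FILE PROVES (theorems only; 0 `def`; 0 sorry; standard axioms).
* §1 the two-space composition calculus over `B9Thm34Ext.toB6 g R H` (generic carriers `X`, `Y`, `Z` with block maps): `hasMajorantHom_rate_mono`;
  **`hasMajorantHom_comp_decay`** — `T₁ : Y → Z` with majorant `A₁w₁(y)e^{−r d}`, `T₂ : X → Y` with `A₂w₂(y)e^{−ρ d}`, `r ≧ ρ + (α+β)δ₀`, the scale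
  transfer of `w₂` at exponent `α` (constant `C`) and (2.61) at `β` give `T₁ ∘ₗ T₂ : X → Z` the majorant `A₁A₂Cc₁(β)·w₁w₂·e^{−ρ d}` (= the two-space
  twin of `B9Ineq366CPrime.hasMajorant_comp_decay`; the y″-sum is its `conv_le`); `hasMajorantHom_local_comp` / `hasMajorantHom_comp_local` — a
  BLOCK-LOCAL letter (majorant `κ·𝟙[y = y′]`, the shape of `Q′`, `Q′*` of (3.19)) before/after any letter costs its norm `κ`.
* §2 **`hasMajorantHom_word349`** — the word `X·Q′*·(Q′G′²Q′*)⁻¹·Q′·Y` of (3.25) with generic end letters typed `Y : I → sites`, `X : sites → O`,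
  `Q′ : sites → coarse`, `Q′* : coarse → sites`, `(Q′G′²Q′*)⁻¹` on the coarse lattice: majorant `κ_Q²B_XB₁B_YΛ⁴c² · w_X(Lʲη)⁻⁴w_Y · e^{−ρ d}` for
  `ρ + (2α+β)δ₀ ≦ δ` (two scale transfers at `2α`, `B9Ineq368PPrime.transfers_word`).
* §3 **`ineq349_hom`** — **(3.49), all four entries, letters typed between their carriers**: for `P(U) := G ∘ₗ Q′* ∘ₗ C⁻¹ ∘ₗ Q′ ∘ₗ G` on the site
  carrier `X`, `D : X → Y` (bonds), `D* : Y → X`, from (3.42)₁ `G ≺ B₀(Lʲη)²e^{−δd}`, (3.42)₂ `D ∘ₗ G ≺ B₀Lʲη e^{−δd}` (sites → bonds), (3.42)₃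
  `G ∘ₗ D* ≺ B₀Lʲη e^{−δd}` (bonds → sites), (3.48) `C⁻¹ ≺ B₁(Lʲη)⁻⁴e^{−δd}` (coarse lattice), `Q′`, `Q′*` block-local with norm `κ_Q`, the scale
  transfers for `Lʲη`, `(Lʲη)²`, `(Lʲη)⁻⁴` at exponent `α` (constant `Λ ≧ 1`), (2.61) at `β`, (2.54):  `P ≺ κ₃₄₉e^{−ρd}` (sites), `D ∘ₗ P ≺
  κ₃₄₉(Lʲη)⁻¹e^{−ρd}` (sites → bonds), `P ∘ₗ D* ≺ κ₃₄₉(Lʲη)⁻¹e^{−ρd}` (bonds → sites), `D ∘ₗ P ∘ₗ D* ≺ κ₃₄₉(Lʲη)⁻²e^{−ρd}` (bonds), for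
  `ρ + (2α+β)δ₀ ≦ δ`, with THE SAME constant `κ₃₄₉ = B9Ineq368PPrime.kappa349 κ_Q B₀ B₁ Λ c = κ_Q²B₀²B₁Λ⁴c²` as the one-carrier form; the first
  three conjuncts ARE the hypothesis shapes `hP`/`hDP`/`hPDs` of `thm34_G_entries13_concreteV₃P₁` (`κ_P := κ₃₄₉`, `δ_P := ρ`).

HONEST SCOPE / NOT CLAIMED.  (i) Operator (block `L^∞ → L^∞`) form, as every consumer in the tree uses; the printed POINTWISE kernel form with the
factor `(L^{j′}η)^{−d}` is stronger and is pv16's `B9Ineq349.ineq349_of_thms31to33` (modulo its kernel-composition dictionary) — row B9.Eq3.49's head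
is unchanged by this file.  (ii) Theorems 3.1/3.2 are INPUTS of printed shape (hypotheses `hG`, `hDG`, `hGDs`, `hCinv`), as are the block-locality of
`Q′`, `Q′*` ((3.19): unitary transports, `κ_Q = 1` in print) and Lemma 2.1 of [4]; the cell's typed Theorem 3.1 delivers `hG`/`hDG`/`hGDs` through
`B9Thm37GlueCor36.hasMajorantHom_of_thm31` for operators realizing its observation quantities.  (iii) The Hölder sentence after (3.49) is not typed
(cell GAPS G-B9-02).  (iv) Rate `ρ` vs the printed `½δ₀`: the re-defined-constants convention, `B9Ineq349.rates_349`.  Value = bookkeeping that lets the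
concrete Thm 3.4 chain consume Theorem 3.1/3.2-shaped inputs for `P(U)`; NOT summit progress.

RELATED IN THE TREE, NOT DUPLICATED (searched 2026-08-22: `lean search 'Ineq349Hom|ineq349_hom|hasMajorantHom_comp_decay|hasMajorantHom_word'` = ∅;
`lean search 'hasMajorantHom_' --decl` read: `B6RandomWalkHom.hasMajorantHom_comp` (USED BY NAME, the only composition lemma for two-space majorants;
`hom_majorant_mul_265` is the special case `S ∘ₗ T` with `T` an endomorphism and unweighted), `B9Thm37Glue.hasMajorantHom_sandwich_local` /
`hasMajorantHom_mulOp_local` (local letters given as multiplication operators / sandwiches on concrete carriers, not the `κ·𝟙[y = y′]` majorant shape),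
`B9Eq376POneLetters.hasMajorantHom_of_local` (stencil-local letters ⇒ majorant; a producer of inputs, not a composition rule)); `B9Ineq368PPrime`
(`kappa349`, `transfers_word` USED BY NAME; its §2–§3 are the one-carrier originals of §2–§3 here); `B9Ineq366CPrime.conv_le` (the y″-sum, USED BY
NAME); `B9Ineq349` (pv16, pointwise kernel form).
-/

noncomputable section

namespace Literature.MathematicalPhysics.QuantumFieldTheory.Balaban1983to89.B9Ineq349Hom

open Literature.MathematicalPhysics.QuantumFieldTheory.Balaban1983to89
open Literature.MathematicalPhysics.QuantumFieldTheory.Balaban1983to89.B6RandomWalk (HasMajorant BlockSupp hasMajorant_mono Triangle254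
  Ineq261)
open Literature.MathematicalPhysics.QuantumFieldTheory.Balaban1983to89.B6RandomWalkHom (HasMajorantHom hasMajorantHom_mono
  hasMajorantHom_comp hasMajorantHom_iff)
open Literature.MathematicalPhysics.QuantumFieldTheory.Balaban1983to89.B9Thm34Ext (toB6)
open Literature.MathematicalPhysics.QuantumFieldTheory.Balaban1983to89.B9Ineq347 (ScaleTransfer)
open Literature.MathematicalPhysics.QuantumFieldTheory.Balaban1983to89.B9Ineq366CPrime (conv_le)
open Literature.MathematicalPhysics.QuantumFieldTheory.Balaban1983to89.B9Ineq368PPrime (kappa349 transfers_word)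

/-! ## §1  Two-space composition calculus ([4] (2.52)–(2.55) through a middle lattice, + the y″-sum of [4] (2.68)) -/

section Calculus

variable {g : B9.Geometry} [Fintype g.Site] {R : ℝ} {H : Prop} {X Y Z : Type}

omit [Fintype g.Site] in
/-- Rate monotonicity of the exponential weight: `ρ ≦ r`, `t ≧ 0` ⟹ `e^{−rt} ≦ e^{−ρt}`. [folklore] -/
private theorem exp_rate_mono {ρ r t : ℝ} (h : ρ ≤ r) (ht : 0 ≤ t) : Real.exp (-(r * t)) ≤ Real.exp (-(ρ * t)) :=
  Real.exp_le_exp.mpr (by nlinarith)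

/-- Weakening the rate of a two-space (2.51)-majorant `A·w(y)·e^{−r d(y,y′)}` to `ρ ≦ r` (a larger majorant is a majorant).
[cite: Balaban1984PropagatorsII, (2.51) p.232; Balaban1985BackgroundPropagators, (3.42) p.397] -/
theorem hasMajorantHom_rate_mono (blkX : X → g.Site) (blkY : Y → g.Site) {T : (X → ℝ) →ₗ[ℝ] (Y → ℝ)} (A : ℝ)
    (w : g.Site → ℝ) {ρ r : ℝ} (hA : 0 ≤ A) (hw : ∀ a, 0 ≤ w a) (hρr : ρ ≤ r) (hdnn : ∀ a b : g.Site, 0 ≤ g.dist a b)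
    (h : HasMajorantHom (g := toB6 g R H) blkX blkY T (fun a b => A * w a * Real.exp (-(r * g.dist a b)))) :
    HasMajorantHom (g := toB6 g R H) blkX blkY T (fun a b => A * w a * Real.exp (-(ρ * g.dist a b))) :=
  hasMajorantHom_mono (g := toB6 g R H) blkX blkY h fun a b =>
    mul_le_mul_of_nonneg_left (exp_rate_mono hρr (hdnn a b)) (mul_nonneg hA (hw a))

/-- **Composition of two decaying two-space majorants through a middle lattice** ([4] (2.52)–(2.55): *"this property is preserved under the
composition of operators possessing it"*; the y″-sum *"in the same way as in the bounds (2.68) in [4]"*, B9 p. 403): `T₁ : (Y → ℝ) → (Z → ℝ)` with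
majorant `A₁w₁(y)e^{−r d}` (rate `r ≧ ρ + (α+β)δ₀`), `T₂ : (X → ℝ) → (Y → ℝ)` with majorant `A₂w₂(y)e^{−ρ d}`, the scale transfer at exponent `α` with
constant `C` for `w₂` and (2.61) at exponent `β` give `T₁ ∘ₗ T₂ : (X → ℝ) → (Z → ℝ)` the majorant `A₁A₂Cc₁(β)·w₁(y)w₂(y)·e^{−ρ d(y,y′)}`.
[cite: Balaban1984PropagatorsII, (2.52)–(2.55) p.232 + (2.68) p.235 + Lemma 2.1 p.234; Balaban1985BackgroundPropagators, (3.49) p.399 + p.398 remark after (3.47)] -/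
theorem hasMajorantHom_comp_decay (blkX : X → g.Site) (blkY : Y → g.Site) (blkZ : Z → g.Site) (d : ℕ)
    (δ₀ α β ρ r C A₁ A₂ : ℝ) (w₁ w₂ : g.Site → ℝ)
    (hw₁ : ∀ a, 0 ≤ w₁ a) (hw₂ : ∀ a, 0 ≤ w₂ a) (hC : 0 ≤ C) (hA₁ : 0 ≤ A₁) (hA₂ : 0 ≤ A₂) (hρ : 0 ≤ ρ)
    (hr : ρ + (α + β) * δ₀ ≤ r) (hdnn : ∀ a b : g.Site, 0 ≤ g.dist a b)
    (htri : Triangle254 (toB6 g R H)) (hST : ScaleTransfer g δ₀ α C w₂)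
    (h261 : Ineq261 d (toB6 g R H) δ₀ β) {T₁ : (Y → ℝ) →ₗ[ℝ] (Z → ℝ)} {T₂ : (X → ℝ) →ₗ[ℝ] (Y → ℝ)}
    (h₁ : HasMajorantHom (g := toB6 g R H) blkY blkZ T₁ (fun a b => A₁ * w₁ a * Real.exp (-(r * g.dist a b))))
    (h₂ : HasMajorantHom (g := toB6 g R H) blkX blkY T₂ (fun a b => A₂ * w₂ a * Real.exp (-(ρ * g.dist a b)))) :
    HasMajorantHom (g := toB6 g R H) blkX blkZ (T₁ ∘ₗ T₂)
      (fun a b => (A₁ * A₂ * C * B6.c1 d δ₀ β) * (w₁ a * w₂ a) * Real.exp (-(ρ * g.dist a b))) := by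
  have hK₂ : ∀ a b : g.Site, 0 ≤ A₂ * w₂ a * Real.exp (-(ρ * g.dist a b)) := fun a b =>
    mul_nonneg (mul_nonneg hA₂ (hw₂ a)) (Real.exp_nonneg _)
  refine hasMajorantHom_mono (g := toB6 g R H) blkX blkZ
    (hasMajorantHom_comp (g := toB6 g R H) blkX blkY blkZ h₁ h₂ hK₂) fun a b => ?_
  have hc := conv_le (R := R) (H := H) d δ₀ α β ρ r C w₁ w₂ hw₁ hw₂ hC hρ hr hdnn htri hST h261 a b
  calc ∑ c : g.Site, A₁ * w₁ a * Real.exp (-(r * g.dist a c)) * (A₂ * w₂ c * Real.exp (-(ρ * g.dist c b)))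
      = (A₁ * A₂) * ∑ c : g.Site, (w₁ a * Real.exp (-(r * g.dist a c))) * (w₂ c * Real.exp (-(ρ * g.dist c b))) := by
        rw [Finset.mul_sum]
        exact Finset.sum_congr rfl fun c _ => by ring
    _ ≤ (A₁ * A₂) * (C * B6.c1 d δ₀ β * (w₁ a * w₂ a) * Real.exp (-(ρ * g.dist a b))) :=
        mul_le_mul_of_nonneg_left hc (mul_nonneg hA₁ hA₂)
    _ = (A₁ * A₂ * C * B6.c1 d δ₀ β) * (w₁ a * w₂ a) * Real.exp (-(ρ * g.dist a b)) := by ring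

/-- A BLOCK-LOCAL letter AFTER any letter (the shape of `Q′(U)` of (3.19): the value on the block `Δ(y)` of the target lattice depends on the argument on
the block `Δ(y)` of the source lattice only, with norm `≦ κ`): if `T₁ : (Y → ℝ) → (Z → ℝ)` has the block-diagonal majorant `κ·𝟙[y = y′]` and
`T₂ : (X → ℝ) → (Y → ℝ)` the majorant `K ≧ 0`, then `T₁ ∘ₗ T₂` has majorant `κ·K`.
[cite: Balaban1985BackgroundPropagators, (3.19) p.393 + (3.49) p.399; Balaban1984PropagatorsII, (2.52) p.232] -/
theorem hasMajorantHom_local_comp [DecidableEq g.Site] (blkX : X → g.Site) (blkY : Y → g.Site) (blkZ : Z → g.Site) (κ : ℝ)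
    {T₁ : (Y → ℝ) →ₗ[ℝ] (Z → ℝ)} {T₂ : (X → ℝ) →ₗ[ℝ] (Y → ℝ)} {K : g.Site → g.Site → ℝ} (hK : ∀ a b, 0 ≤ K a b)
    (h₁ : HasMajorantHom (g := toB6 g R H) blkY blkZ T₁ (fun a b : g.Site => if a = b then κ else 0))
    (h₂ : HasMajorantHom (g := toB6 g R H) blkX blkY T₂ K) :
    HasMajorantHom (g := toB6 g R H) blkX blkZ (T₁ ∘ₗ T₂) (fun a b => κ * K a b) := by
  refine hasMajorantHom_mono (g := toB6 g R H) blkX blkZ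
    (hasMajorantHom_comp (g := toB6 g R H) blkX blkY blkZ h₁ h₂ hK) fun a b => le_of_eq ?_
  simp [ite_mul]

/-- A BLOCK-LOCAL letter BEFORE any letter (the shape of `Q′*(U)`, block-diagonal majorant `κ·𝟙[y = y′]` with `κ ≧ 0`): if `T₁ : (Y → ℝ) → (Z → ℝ)` has
the majorant `K` and `T₂ : (X → ℝ) → (Y → ℝ)` is block-local with norm `κ`, then `T₁ ∘ₗ T₂` has majorant `K·κ`.
[cite: Balaban1985BackgroundPropagators, (3.19) p.393 + (3.49) p.399; Balaban1984PropagatorsII, (2.52) p.232] -/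
theorem hasMajorantHom_comp_local [DecidableEq g.Site] (blkX : X → g.Site) (blkY : Y → g.Site) (blkZ : Z → g.Site) (κ : ℝ)
    (hκ : 0 ≤ κ) {T₁ : (Y → ℝ) →ₗ[ℝ] (Z → ℝ)} {T₂ : (X → ℝ) →ₗ[ℝ] (Y → ℝ)} {K : g.Site → g.Site → ℝ}
    (h₁ : HasMajorantHom (g := toB6 g R H) blkY blkZ T₁ K)
    (h₂ : HasMajorantHom (g := toB6 g R H) blkX blkY T₂ (fun a b : g.Site => if a = b then κ else 0)) :
    HasMajorantHom (g := toB6 g R H) blkX blkZ (T₁ ∘ₗ T₂) (fun a b => K a b * κ) := by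
  have hK₂ : ∀ a b : g.Site, 0 ≤ (if a = b then κ else 0) := fun a b => by
    split_ifs
    · exact hκ
    · exact le_rfl
  refine hasMajorantHom_mono (g := toB6 g R H) blkX blkZ
    (hasMajorantHom_comp (g := toB6 g R H) blkX blkY blkZ h₁ h₂ hK₂) fun a b => le_of_eq ?_
  simp [mul_ite]

end Calculus

/-! ## §2  The word `X·Q′*·(Q′G′²Q′*)⁻¹·Q′·Y` of (3.25), every letter between its own carriers -/

section Word

variable {g : B9.Geometry} [Fintype g.Site] [DecidableEq g.Site] {R : ℝ} {H : Prop} {I O X Z : Type}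

/-- **The word `X·Q′*·(Q′G′²Q′*)⁻¹·Q′·Y` of (3.25) with generic end letters, each letter typed between its carriers** (*"using again Lemma 2.1"*,
p. 399): `Y : (I → ℝ) → (X → ℝ)` with majorant `B_Y w_Y e^{−δ d}` (`Y ∈ {G′, G′∇*}`: `I` = sites resp. bonds, `w_Y = (Lʲη)², Lʲη` by (3.42)₁,₃),
`Q′ : (X → ℝ) → (Z → ℝ)` (sites → coarse lattice) and `Q′* : (Z → ℝ) → (X → ℝ)` block-local with norm `κ_Q` ((3.19)), `(Q′G′²Q′*)⁻¹` on the coarse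
lattice with the (3.48)-majorant `B₁(Lʲη)⁻⁴e^{−δ d}`, `X : (X → ℝ) → (O → ℝ)` with `B_X w_X e^{−δ d}` (`X ∈ {G′, ∇G′}`: `O` = sites resp. bonds):
the word has the majorant `κ_Q²B_XB₁B_Y Λ⁴c² · w_X(Lʲη)⁻⁴w_Y · e^{−ρ d}` for `ρ + (2α+β)δ₀ ≦ δ` (the scale transfers for `w_Y` and `(Lʲη)⁻⁴` at
exponent `α` with constant `Λ ≧ 1`, composed at `2α` by `B9Ineq368PPrime.transfers_word`; (2.61) at `β`; (2.54)).
[cite: Balaban1985BackgroundPropagators, (3.25) p.394 + (3.42) p.397 + (3.48) p.398 + (3.49) p.399 + (3.19) p.393; Balaban1984PropagatorsII, Lemma 2.1 p.234 + (2.52) p.232] -/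
theorem hasMajorantHom_word349 (blkI : I → g.Site) (blkO : O → g.Site) (blkX : X → g.Site) (blkZ : Z → g.Site) (d : ℕ)
    (δ₀ δ α β ρ Λ κQ BX B₁ BY : ℝ) (wX wY : g.Site → ℝ)
    (hwX : ∀ a, 0 ≤ wX a) (hwY : ∀ a, 0 ≤ wY a) (hκQ : 0 ≤ κQ) (hBX : 0 ≤ BX) (hB₁ : 0 ≤ B₁) (hBY : 0 ≤ BY)
    (hΛ : 1 ≤ Λ) (hρ : 0 ≤ ρ) (hα : 0 ≤ α) (hβ : 0 ≤ β) (hδ₀ : 0 ≤ δ₀) (hr : ρ + (2 * α + β) * δ₀ ≤ δ)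
    (hdnn : ∀ a b : g.Site, 0 ≤ g.dist a b) (htri : Triangle254 (toB6 g R H))
    (h261 : Ineq261 d (toB6 g R H) δ₀ β)
    (hTY : ScaleTransfer g δ₀ α Λ wY) (hT4 : ScaleTransfer g δ₀ α Λ (fun a => (g.len a ^ 4)⁻¹))
    {Xl : (X → ℝ) →ₗ[ℝ] (O → ℝ)} {Yl : (I → ℝ) →ₗ[ℝ] (X → ℝ)} {Q : (X → ℝ) →ₗ[ℝ] (Z → ℝ)}
    {Qs : (Z → ℝ) →ₗ[ℝ] (X → ℝ)} {Cinv : Module.End ℝ (Z → ℝ)}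
    (hX : HasMajorantHom (g := toB6 g R H) blkX blkO Xl (fun a b => BX * wX a * Real.exp (-(δ * g.dist a b))))
    (hY : HasMajorantHom (g := toB6 g R H) blkI blkX Yl (fun a b => BY * wY a * Real.exp (-(δ * g.dist a b))))
    (hQ : HasMajorantHom (g := toB6 g R H) blkX blkZ Q (fun a b : g.Site => if a = b then κQ else 0))
    (hQs : HasMajorantHom (g := toB6 g R H) blkZ blkX Qs (fun a b : g.Site => if a = b then κQ else 0))
    (hCinv : HasMajorant (g := toB6 g R H) blkZ Cinv (fun a b => B₁ * (g.len a ^ 4)⁻¹ * Real.exp (-(δ * g.dist a b)))) :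
    HasMajorantHom (g := toB6 g R H) blkI blkO (Xl ∘ₗ Qs ∘ₗ Cinv ∘ₗ Q ∘ₗ Yl)
      (fun a b => (κQ ^ 2 * BX * B₁ * BY * Λ ^ 4 * B6.c1 d δ₀ β ^ 2) * (wX a * ((g.len a ^ 4)⁻¹ * wY a)) *
        Real.exp (-(ρ * g.dist a b))) := by
  have hc0 : 0 ≤ B6.c1 d δ₀ β := B6RandomWalk.c1_nonneg d δ₀ β
  have hΛ0 : 0 ≤ Λ := zero_le_one.trans hΛ
  have hw4 : ∀ a : g.Site, 0 ≤ (g.len a ^ 4)⁻¹ := fun a => inv_nonneg.mpr (by positivity)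
  have hw4Y : ∀ a : g.Site, 0 ≤ (g.len a ^ 4)⁻¹ * wY a := fun a => mul_nonneg (hw4 a) (hwY a)
  have hρδ : ρ ≤ δ := by nlinarith
  have hr' : ρ + (2 * α + β) * δ₀ ≤ δ := hr
  obtain ⟨tY, t4Y⟩ := transfers_word (g := g) hwY hΛ hα hδ₀ hdnn hTY hT4
  -- the right end letter at the output rate ρ
  have hYρ : HasMajorantHom (g := toB6 g R H) blkI blkX Yl (fun a b => BY * wY a * Real.exp (-(ρ * g.dist a b))) :=
    hasMajorantHom_rate_mono (R := R) (H := H) blkI blkX BY wY hBY hwY hρδ hdnn hY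
  have hKY : ∀ a b : g.Site, 0 ≤ BY * wY a * Real.exp (-(ρ * g.dist a b)) := fun a b => by
    have := hwY a; positivity
  -- Q′·Y
  have s1 : HasMajorantHom (g := toB6 g R H) blkI blkZ (Q ∘ₗ Yl)
      (fun a b => (κQ * BY) * wY a * Real.exp (-(ρ * g.dist a b))) :=
    hasMajorantHom_mono (g := toB6 g R H) blkI blkZ
      (hasMajorantHom_local_comp (R := R) (H := H) blkI blkX blkZ κQ hKY hQ hYρ) fun a b => le_of_eq (by ring)
  -- C⁻¹·(Q′·Y)
  have hCinv' : HasMajorantHom (g := toB6 g R H) blkZ blkZ Cinv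
      (fun a b => B₁ * (g.len a ^ 4)⁻¹ * Real.exp (-(δ * g.dist a b))) :=
    (hasMajorantHom_iff (g := toB6 g R H) blkZ Cinv _).mpr hCinv
  have s2 : HasMajorantHom (g := toB6 g R H) blkI blkZ (Cinv ∘ₗ (Q ∘ₗ Yl))
      (fun a b => (B₁ * (κQ * BY) * Λ ^ 2 * B6.c1 d δ₀ β) * ((g.len a ^ 4)⁻¹ * wY a) *
        Real.exp (-(ρ * g.dist a b))) :=
    hasMajorantHom_comp_decay (R := R) (H := H) blkI blkZ blkZ d δ₀ (2 * α) β ρ δ (Λ ^ 2) B₁ (κQ * BY)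
      (fun a => (g.len a ^ 4)⁻¹) wY hw4 hwY (by positivity) hB₁ (mul_nonneg hκQ hBY) hρ hr' hdnn htri tY h261 hCinv' s1
  have hK2 : ∀ a b : g.Site, 0 ≤ (B₁ * (κQ * BY) * Λ ^ 2 * B6.c1 d δ₀ β) * ((g.len a ^ 4)⁻¹ * wY a) *
      Real.exp (-(ρ * g.dist a b)) := fun a b => by
    have := hw4Y a; positivity
  -- Q′*·(C⁻¹·(Q′·Y))
  have s3 : HasMajorantHom (g := toB6 g R H) blkI blkX (Qs ∘ₗ (Cinv ∘ₗ (Q ∘ₗ Yl)))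
      (fun a b => (κQ * (B₁ * (κQ * BY) * Λ ^ 2 * B6.c1 d δ₀ β)) * ((g.len a ^ 4)⁻¹ * wY a) *
        Real.exp (-(ρ * g.dist a b))) :=
    hasMajorantHom_mono (g := toB6 g R H) blkI blkX
      (hasMajorantHom_local_comp (R := R) (H := H) blkI blkZ blkX κQ hK2 hQs s2) fun a b => le_of_eq (by ring)
  -- X·(Q′*·(C⁻¹·(Q′·Y)))
  have s4 : HasMajorantHom (g := toB6 g R H) blkI blkO (Xl ∘ₗ (Qs ∘ₗ (Cinv ∘ₗ (Q ∘ₗ Yl))))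
      (fun a b => (BX * (κQ * (B₁ * (κQ * BY) * Λ ^ 2 * B6.c1 d δ₀ β)) * Λ ^ 2 * B6.c1 d δ₀ β) *
        (wX a * ((g.len a ^ 4)⁻¹ * wY a)) * Real.exp (-(ρ * g.dist a b))) :=
    hasMajorantHom_comp_decay (R := R) (H := H) blkI blkX blkO d δ₀ (2 * α) β ρ δ (Λ ^ 2) BX
      (κQ * (B₁ * (κQ * BY) * Λ ^ 2 * B6.c1 d δ₀ β)) wX (fun a => (g.len a ^ 4)⁻¹ * wY a) hwX hw4Y (by positivity) hBX
      (by positivity) hρ hr' hdnn htri t4Y h261 hX s3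
  exact hasMajorantHom_mono (g := toB6 g R H) blkI blkO s4 fun a b => le_of_eq (by ring)

/-- **The same word with TWO block-local constants** — `Q′` with `κ_Q` and `Q′*` with `κ_{Q*}` kept apart (appended 2026-08-28 on the word of
cell `lit-balaban` p38 g46: in a telescoped DIFFERENCE of two (3.25) words exactly one of `Q′`, `Q′*` is the differenced letter carrying a small
constant while the other keeps `κ_Q`; with one shared constant the smallness would be lost).  Same proof as `hasMajorantHom_word349`; the word has
the majorant `κ_Qκ_{Q*}B_XB₁B_Y Λ⁴c² · w_X(Lʲη)⁻⁴w_Y · e^{−ρ d}` for `ρ + (2α+β)δ₀ ≦ δ`.  Nothing of the paper is asserted beyond (3.25)'s word shape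
and *"using again Lemma 2.1"* (p. 399).
[cite: Balaban1985BackgroundPropagators, (3.25) p.394 + (3.42) p.397 + (3.48) p.398 + (3.49) p.399 + (3.19) p.393; Balaban1984PropagatorsII, Lemma 2.1 p.234 + (2.52) p.232] -/
theorem hasMajorantHom_word349₂ (blkI : I → g.Site) (blkO : O → g.Site) (blkX : X → g.Site) (blkZ : Z → g.Site) (d : ℕ)
    (δ₀ δ α β ρ Λ κQ κQs BX B₁ BY : ℝ) (wX wY : g.Site → ℝ)
    (hwX : ∀ a, 0 ≤ wX a) (hwY : ∀ a, 0 ≤ wY a) (hκQ : 0 ≤ κQ) (hκQs : 0 ≤ κQs) (hBX : 0 ≤ BX) (hB₁ : 0 ≤ B₁) (hBY : 0 ≤ BY)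
    (hΛ : 1 ≤ Λ) (hρ : 0 ≤ ρ) (hα : 0 ≤ α) (hβ : 0 ≤ β) (hδ₀ : 0 ≤ δ₀) (hr : ρ + (2 * α + β) * δ₀ ≤ δ)
    (hdnn : ∀ a b : g.Site, 0 ≤ g.dist a b) (htri : Triangle254 (toB6 g R H))
    (h261 : Ineq261 d (toB6 g R H) δ₀ β)
    (hTY : ScaleTransfer g δ₀ α Λ wY) (hT4 : ScaleTransfer g δ₀ α Λ (fun a => (g.len a ^ 4)⁻¹))
    {Xl : (X → ℝ) →ₗ[ℝ] (O → ℝ)} {Yl : (I → ℝ) →ₗ[ℝ] (X → ℝ)} {Q : (X → ℝ) →ₗ[ℝ] (Z → ℝ)}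
    {Qs : (Z → ℝ) →ₗ[ℝ] (X → ℝ)} {Cinv : Module.End ℝ (Z → ℝ)}
    (hX : HasMajorantHom (g := toB6 g R H) blkX blkO Xl (fun a b => BX * wX a * Real.exp (-(δ * g.dist a b))))
    (hY : HasMajorantHom (g := toB6 g R H) blkI blkX Yl (fun a b => BY * wY a * Real.exp (-(δ * g.dist a b))))
    (hQ : HasMajorantHom (g := toB6 g R H) blkX blkZ Q (fun a b : g.Site => if a = b then κQ else 0))
    (hQs : HasMajorantHom (g := toB6 g R H) blkZ blkX Qs (fun a b : g.Site => if a = b then κQs else 0))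
    (hCinv : HasMajorant (g := toB6 g R H) blkZ Cinv (fun a b => B₁ * (g.len a ^ 4)⁻¹ * Real.exp (-(δ * g.dist a b)))) :
    HasMajorantHom (g := toB6 g R H) blkI blkO (Xl ∘ₗ Qs ∘ₗ Cinv ∘ₗ Q ∘ₗ Yl)
      (fun a b => (κQ * κQs * BX * B₁ * BY * Λ ^ 4 * B6.c1 d δ₀ β ^ 2) * (wX a * ((g.len a ^ 4)⁻¹ * wY a)) *
        Real.exp (-(ρ * g.dist a b))) := by
  have hc0 : 0 ≤ B6.c1 d δ₀ β := B6RandomWalk.c1_nonneg d δ₀ β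
  have hΛ0 : 0 ≤ Λ := zero_le_one.trans hΛ
  have hw4 : ∀ a : g.Site, 0 ≤ (g.len a ^ 4)⁻¹ := fun a => inv_nonneg.mpr (by positivity)
  have hw4Y : ∀ a : g.Site, 0 ≤ (g.len a ^ 4)⁻¹ * wY a := fun a => mul_nonneg (hw4 a) (hwY a)
  have hρδ : ρ ≤ δ := by nlinarith
  have hr' : ρ + (2 * α + β) * δ₀ ≤ δ := hr
  obtain ⟨tY, t4Y⟩ := transfers_word (g := g) hwY hΛ hα hδ₀ hdnn hTY hT4
  -- the right end letter at the output rate ρ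
  have hYρ : HasMajorantHom (g := toB6 g R H) blkI blkX Yl (fun a b => BY * wY a * Real.exp (-(ρ * g.dist a b))) :=
    hasMajorantHom_rate_mono (R := R) (H := H) blkI blkX BY wY hBY hwY hρδ hdnn hY
  have hKY : ∀ a b : g.Site, 0 ≤ BY * wY a * Real.exp (-(ρ * g.dist a b)) := fun a b => by
    have := hwY a; positivity
  -- Q′·Y (constant κ_Q)
  have s1 : HasMajorantHom (g := toB6 g R H) blkI blkZ (Q ∘ₗ Yl)
      (fun a b => (κQ * BY) * wY a * Real.exp (-(ρ * g.dist a b))) :=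
    hasMajorantHom_mono (g := toB6 g R H) blkI blkZ
      (hasMajorantHom_local_comp (R := R) (H := H) blkI blkX blkZ κQ hKY hQ hYρ) fun a b => le_of_eq (by ring)
  -- C⁻¹·(Q′·Y)
  have hCinv' : HasMajorantHom (g := toB6 g R H) blkZ blkZ Cinv
      (fun a b => B₁ * (g.len a ^ 4)⁻¹ * Real.exp (-(δ * g.dist a b))) :=
    (hasMajorantHom_iff (g := toB6 g R H) blkZ Cinv _).mpr hCinv
  have s2 : HasMajorantHom (g := toB6 g R H) blkI blkZ (Cinv ∘ₗ (Q ∘ₗ Yl))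
      (fun a b => (B₁ * (κQ * BY) * Λ ^ 2 * B6.c1 d δ₀ β) * ((g.len a ^ 4)⁻¹ * wY a) *
        Real.exp (-(ρ * g.dist a b))) :=
    hasMajorantHom_comp_decay (R := R) (H := H) blkI blkZ blkZ d δ₀ (2 * α) β ρ δ (Λ ^ 2) B₁ (κQ * BY)
      (fun a => (g.len a ^ 4)⁻¹) wY hw4 hwY (by positivity) hB₁ (mul_nonneg hκQ hBY) hρ hr' hdnn htri tY h261 hCinv' s1
  have hK2 : ∀ a b : g.Site, 0 ≤ (B₁ * (κQ * BY) * Λ ^ 2 * B6.c1 d δ₀ β) * ((g.len a ^ 4)⁻¹ * wY a) *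
      Real.exp (-(ρ * g.dist a b)) := fun a b => by
    have := hw4Y a; positivity
  -- Q′*·(C⁻¹·(Q′·Y)) (constant κ_{Q*})
  have s3 : HasMajorantHom (g := toB6 g R H) blkI blkX (Qs ∘ₗ (Cinv ∘ₗ (Q ∘ₗ Yl)))
      (fun a b => (κQs * (B₁ * (κQ * BY) * Λ ^ 2 * B6.c1 d δ₀ β)) * ((g.len a ^ 4)⁻¹ * wY a) *
        Real.exp (-(ρ * g.dist a b))) :=
    hasMajorantHom_mono (g := toB6 g R H) blkI blkX
      (hasMajorantHom_local_comp (R := R) (H := H) blkI blkZ blkX κQs hK2 hQs s2) fun a b => le_of_eq (by ring)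
  -- X·(Q′*·(C⁻¹·(Q′·Y)))
  have s4 : HasMajorantHom (g := toB6 g R H) blkI blkO (Xl ∘ₗ (Qs ∘ₗ (Cinv ∘ₗ (Q ∘ₗ Yl))))
      (fun a b => (BX * (κQs * (B₁ * (κQ * BY) * Λ ^ 2 * B6.c1 d δ₀ β)) * Λ ^ 2 * B6.c1 d δ₀ β) *
        (wX a * ((g.len a ^ 4)⁻¹ * wY a)) * Real.exp (-(ρ * g.dist a b))) :=
    hasMajorantHom_comp_decay (R := R) (H := H) blkI blkX blkO d δ₀ (2 * α) β ρ δ (Λ ^ 2) BX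
      (κQs * (B₁ * (κQ * BY) * Λ ^ 2 * B6.c1 d δ₀ β)) wX (fun a => (g.len a ^ 4)⁻¹ * wY a) hwX hw4Y (by positivity) hBX
      (by positivity) hρ hr' hdnn htri t4Y h261 hX s3
  exact hasMajorantHom_mono (g := toB6 g R H) blkI blkO s4 fun a b => le_of_eq (by ring)

end Word

/-! ## §3  (3.49) p. 399, all four entries, with `G′` on the sites, `Q′`/`Q′*` to and from the coarse lattice, `D`/`D*` to and from the bonds -/

section Ineq349

variable {g : B9.Geometry} [Fintype g.Site] [DecidableEq g.Site] {R : ℝ} {H : Prop} {X Y Z : Type}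

/-- **(3.49) p. 399 — *"For the operator P = I − R we obtain, using again Lemma 2.1, [|P(x,x′)|, |(DP)_μ(x,x′)|, |(PD\*)_ν(x,x′)|,
|(DPD\*)_{μν}(x,x′)|] ≦ O(1)[1, (Lʲη)⁻¹, (Lʲη)⁻¹, (Lʲη)⁻²](L^{j′}η)^{−d}e^{−(1/2)δ₀d(y,y′)}"* — block-majorant (operator) form of [4] (2.51), all four
entries, EVERY LETTER TYPED BETWEEN ITS OWN CARRIERS.**  `X` = sites (block map `blkX`), `Y` = bonds (`blkY`), `Z` = the coarse lattice `𝔅` or its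
coordinates (`blkZ`); `P(U) = G ∘ₗ Q′* ∘ₗ C⁻¹ ∘ₗ Q′ ∘ₗ G` ((3.25), `C⁻¹ = (Q′G′²Q′*)⁻¹`); `D : (X → ℝ) → (Y → ℝ)`, `D* : (Y → ℝ) → (X → ℝ)` the
derivative letters `∇_U`, `∇*_U`.  INPUTS of printed shape: (3.42)₁ `G ≺ B₀(Lʲη)²e^{−δd}` (`hG`), (3.42)₂ `D ∘ₗ G ≺ B₀Lʲη e^{−δd}` (`hDG`, sites → bonds),
(3.42)₃ `G ∘ₗ D* ≺ B₀Lʲη e^{−δd}` (`hGDs`, bonds → sites), (3.48) `C⁻¹ ≺ B₁(Lʲη)⁻⁴e^{−δd}` on the coarse lattice (`hCinv`, pairing form), `Q′`, `Q′*`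
block-local with norm `κ_Q` ((3.19)), the scale transfers of the p. 398 remark for the weights `Lʲη`, `(Lʲη)²`, `(Lʲη)⁻⁴` at exponent `α` with constant
`Λ ≧ 1`, (2.61) at `β`, (2.54), `d ≧ 0`, `Lʲη > 0`.  CONCLUSION, for `ρ + (2α+β)δ₀ ≦ δ`: `P ≺ κ₃₄₉e^{−ρd}` (sites), `D ∘ₗ P ≺ κ₃₄₉(Lʲη)⁻¹e^{−ρd}`
(sites → bonds), `P ∘ₗ D* ≺ κ₃₄₉(Lʲη)⁻¹e^{−ρd}` (bonds → sites), `D ∘ₗ P ∘ₗ D* ≺ κ₃₄₉(Lʲη)⁻²e^{−ρd}` (bonds), `κ₃₄₉ = B9Ineq368PPrime.kappa349 κ_Q B₀ B₁ Λ c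
= κ_Q²B₀²B₁Λ⁴c²` — the constant of the one-carrier form `B9Ineq368PPrime.ineq349_op`.  With the extended letters this IS p. 403's *"the operator
P(U′U) satisfies the bounds (3.49)"*.  LOCATED: operator form; the printed pointwise kernel form is pv16's `B9Ineq349.ineq349_of_thms31to33`.
[cite: Balaban1985BackgroundPropagators, (3.49) p.399 + (3.25) p.394 + Thm 3.1 (3.42) p.397 + Thm 3.2 (3.48) p.398 + (3.19) p.393 + (3.68) p.403; Balaban1984PropagatorsII, Lemma 2.1 p.234 + (2.52) p.232] -/
theorem ineq349_hom (blkX : X → g.Site) (blkY : Y → g.Site) (blkZ : Z → g.Site) (d : ℕ) (δ₀ δ α β ρ Λ κQ B₀ B₁ : ℝ)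
    (hκQ : 0 ≤ κQ) (hB₀ : 0 ≤ B₀) (hB₁ : 0 ≤ B₁) (hΛ : 1 ≤ Λ) (hρ : 0 ≤ ρ) (hα : 0 ≤ α) (hβ : 0 ≤ β)
    (hδ₀ : 0 ≤ δ₀) (hr : ρ + (2 * α + β) * δ₀ ≤ δ)
    (hdnn : ∀ a b : g.Site, 0 ≤ g.dist a b) (htri : Triangle254 (toB6 g R H)) (hlen : ∀ y : g.Site, 0 < g.len y)
    (h261 : Ineq261 d (toB6 g R H) δ₀ β)
    (hT1 : ScaleTransfer g δ₀ α Λ (fun a => g.len a)) (hT2 : ScaleTransfer g δ₀ α Λ (fun a => g.len a ^ 2))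
    (hT4 : ScaleTransfer g δ₀ α Λ (fun a => (g.len a ^ 4)⁻¹))
    {G : Module.End ℝ (X → ℝ)} {D : (X → ℝ) →ₗ[ℝ] (Y → ℝ)} {Ds : (Y → ℝ) →ₗ[ℝ] (X → ℝ)}
    {Q : (X → ℝ) →ₗ[ℝ] (Z → ℝ)} {Qs : (Z → ℝ) →ₗ[ℝ] (X → ℝ)} {Cinv : Module.End ℝ (Z → ℝ)}
    (hQ : HasMajorantHom (g := toB6 g R H) blkX blkZ Q (fun a b : g.Site => if a = b then κQ else 0))
    (hQs : HasMajorantHom (g := toB6 g R H) blkZ blkX Qs (fun a b : g.Site => if a = b then κQ else 0))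
    (hG : HasMajorant (g := toB6 g R H) blkX G (fun a b => B₀ * g.len a ^ 2 * Real.exp (-(δ * g.dist a b))))
    (hDG : HasMajorantHom (g := toB6 g R H) blkX blkY (D ∘ₗ G) (fun a b => B₀ * g.len a * Real.exp (-(δ * g.dist a b))))
    (hGDs : HasMajorantHom (g := toB6 g R H) blkY blkX (G ∘ₗ Ds) (fun a b => B₀ * g.len a * Real.exp (-(δ * g.dist a b))))
    (hCinv : HasMajorant (g := toB6 g R H) blkZ Cinv
      (fun a b => B₁ * (g.len a ^ 4)⁻¹ * Real.exp (-(δ * g.dist a b)))) :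
    HasMajorant (g := toB6 g R H) blkX (G ∘ₗ Qs ∘ₗ Cinv ∘ₗ Q ∘ₗ G)
        (fun a b => kappa349 κQ B₀ B₁ Λ (B6.c1 d δ₀ β) * Real.exp (-(ρ * g.dist a b))) ∧
      HasMajorantHom (g := toB6 g R H) blkX blkY (D ∘ₗ (G ∘ₗ Qs ∘ₗ Cinv ∘ₗ Q ∘ₗ G))
        (fun a b => kappa349 κQ B₀ B₁ Λ (B6.c1 d δ₀ β) * (g.len a)⁻¹ * Real.exp (-(ρ * g.dist a b))) ∧
      HasMajorantHom (g := toB6 g R H) blkY blkX ((G ∘ₗ Qs ∘ₗ Cinv ∘ₗ Q ∘ₗ G) ∘ₗ Ds)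
        (fun a b => kappa349 κQ B₀ B₁ Λ (B6.c1 d δ₀ β) * (g.len a)⁻¹ * Real.exp (-(ρ * g.dist a b))) ∧
      HasMajorant (g := toB6 g R H) blkY (D ∘ₗ (G ∘ₗ Qs ∘ₗ Cinv ∘ₗ Q ∘ₗ G) ∘ₗ Ds)
        (fun a b => kappa349 κQ B₀ B₁ Λ (B6.c1 d δ₀ β) * (g.len a ^ 2)⁻¹ * Real.exp (-(ρ * g.dist a b))) := by
  have hw1 : ∀ a : g.Site, 0 ≤ g.len a := fun a => (hlen a).le
  have hw2 : ∀ a : g.Site, 0 ≤ g.len a ^ 2 := fun a => sq_nonneg _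
  have hG' : HasMajorantHom (g := toB6 g R H) blkX blkX G (fun a b => B₀ * g.len a ^ 2 * Real.exp (-(δ * g.dist a b))) :=
    (hasMajorantHom_iff (g := toB6 g R H) blkX G _).mpr hG
  -- the four words, generic lemma
  have e1 := hasMajorantHom_word349 (R := R) (H := H) blkX blkX blkX blkZ d δ₀ δ α β ρ Λ κQ B₀ B₁ B₀ (fun a => g.len a ^ 2)
    (fun a => g.len a ^ 2) hw2 hw2 hκQ hB₀ hB₁ hB₀ hΛ hρ hα hβ hδ₀ hr hdnn htri h261 hT2 hT4 hG' hG' hQ hQs hCinv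
  have e2 := hasMajorantHom_word349 (R := R) (H := H) blkX blkY blkX blkZ d δ₀ δ α β ρ Λ κQ B₀ B₁ B₀ (fun a => g.len a)
    (fun a => g.len a ^ 2) hw1 hw2 hκQ hB₀ hB₁ hB₀ hΛ hρ hα hβ hδ₀ hr hdnn htri h261 hT2 hT4 hDG hG' hQ hQs hCinv
  have e3 := hasMajorantHom_word349 (R := R) (H := H) blkY blkX blkX blkZ d δ₀ δ α β ρ Λ κQ B₀ B₁ B₀ (fun a => g.len a ^ 2)
    (fun a => g.len a) hw2 hw1 hκQ hB₀ hB₁ hB₀ hΛ hρ hα hβ hδ₀ hr hdnn htri h261 hT1 hT4 hG' hGDs hQ hQs hCinv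
  have e4 := hasMajorantHom_word349 (R := R) (H := H) blkY blkY blkX blkZ d δ₀ δ α β ρ Λ κQ B₀ B₁ B₀ (fun a => g.len a)
    (fun a => g.len a) hw1 hw1 hκQ hB₀ hB₁ hB₀ hΛ hρ hα hβ hδ₀ hr hdnn htri h261 hT1 hT4 hDG hGDs hQ hQs hCinv
  have o2 : D ∘ₗ (G ∘ₗ Qs ∘ₗ Cinv ∘ₗ Q ∘ₗ G) = (D ∘ₗ G) ∘ₗ Qs ∘ₗ Cinv ∘ₗ Q ∘ₗ G := by
    simp only [LinearMap.comp_assoc]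
  have o3 : (G ∘ₗ Qs ∘ₗ Cinv ∘ₗ Q ∘ₗ G) ∘ₗ Ds = G ∘ₗ Qs ∘ₗ Cinv ∘ₗ Q ∘ₗ (G ∘ₗ Ds) := by
    simp only [LinearMap.comp_assoc]
  have o4 : D ∘ₗ (G ∘ₗ Qs ∘ₗ Cinv ∘ₗ Q ∘ₗ G) ∘ₗ Ds = (D ∘ₗ G) ∘ₗ Qs ∘ₗ Cinv ∘ₗ Q ∘ₗ (G ∘ₗ Ds) := by
    simp only [LinearMap.comp_assoc]
  refine ⟨?_, ?_, ?_, ?_⟩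
  · refine (hasMajorantHom_iff (g := toB6 g R H) blkX _ _).mp
      (hasMajorantHom_mono (g := toB6 g R H) blkX blkX e1 fun a b => le_of_eq ?_)
    have ha : g.len a ≠ 0 := (hlen a).ne'
    simp only [kappa349]
    field_simp
  · rw [o2]
    refine hasMajorantHom_mono (g := toB6 g R H) blkX blkY e2 fun a b => le_of_eq ?_
    have ha : g.len a ≠ 0 := (hlen a).ne'
    simp only [kappa349]
    field_simp
  · rw [o3]
    refine hasMajorantHom_mono (g := toB6 g R H) blkY blkX e3 fun a b => le_of_eq ?_
    have ha : g.len a ≠ 0 := (hlen a).ne'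
    simp only [kappa349]
    field_simp
  · rw [o4]
    refine (hasMajorantHom_iff (g := toB6 g R H) blkY _ _).mp
      (hasMajorantHom_mono (g := toB6 g R H) blkY blkY e4 fun a b => le_of_eq ?_)
    have ha : g.len a ≠ 0 := (hlen a).ne'
    simp only [kappa349]
    field_simp

end Ineq349

end Literature.MathematicalPhysics.QuantumFieldTheory.Balaban1983to89.B9Ineq349Hom

end
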